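import Literature.Geometry.Lorentzian.BogovskiiGluing
import Literature.Geometry.Lorentzian.AnnulusStarCover
import HarnessLib

/-!
# Weak solvability of the double divergence on the annulus `A₁` (Mao–Oh–Tao's Lemma 2.2, (S1)–(S2))

(trunk G08 = T-LORENTZ; family `gr`; namespace `Literature.Geometry.Lorentzian.MaoOhTao`.)

Mao–Oh–Tao (arXiv:2308.13031), Lemma 2.2 (p. 8): there is an operator `S` on densities `f` on the annulus
`A₁ = {1 < r < 2}` with `∫ f x dx = ∫ f dx = 0` such that (S1) `supp f ⊆ A₁ ⟹ supp S f ⊆ A₁` and (S2)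
`∂_i∂_j (S f)^{ij} = f` (plus the Sobolev bounds (S3), (S4)).  The proof (p. 9) runs a recursion: Lemma 2.3 gives such
an operator on every set star-shaped with respect to a ball, the splitting `f = f₁ + f₂` (`MomentPartition.lean`)
glues two such sets, and `A₁` is a finite union of such sets.  Assembling `BogovskiiGluing.lean` (base case, gluing,
recursion) with `AnnulusStarCover.lean` (fourteen star-shaped annular sectors covering `A₁` in a chain), this file
records the outcome in weak, per-density form:

* `hasWeakDoubleDivInverse_annulus` — `A₁` has weak solvability of the double divergence;
* `exists_weak_doubleDiv_inverse_annulus` — unfolded: every `f ∈ C_c(ℝ³)` with `tsupp f ⊆ A₁` and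
  `∫ f (1, x₁, x₂, x₃) = 0` is `∂_i∂_j S^{ij}` in `𝒟'(ℝ³)` for a field `S` with `supp S^{ij} ⊆ A₁`.

Everything is proved; no definitions, no named facts.  `TODO(general form)`: the paper's `S` is linear in `f` and
bounded `H^{s-2}_c → H^{s}` ((S3), (S4)); neither is asserted here.

## References

* Y. Mao, S.-J. Oh, T. Tao, arXiv:2308.13031 (2023), Lemma 2.2 and its proof, pp. 8–9 (key `MaoOhTao2023`).
-/

noncomputable section

open scoped RealInnerProductSpace
open Set Metric Function MeasureTheory

namespace Literature.Geometry.Lorentzian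

namespace MaoOhTao

/-- Each sector of the gluing sequence has weak solvability of the double divergence (Lemma 2.3 on a set star-shaped
with respect to the ball of radius `1/20` about `(3/2) ω/|ω|`). [cite: MaoOhTao2023, Lemma 2.2 (proof)] -/
theorem hasWeakDoubleDivInverse_annSector_dirSeq (n : ℕ) : HasWeakDoubleDivInverse (annSector (dirSeq n)) :=
  HasWeakDoubleDivInverse.of_starConvex (c := ((3 / 2 : ℝ) * ‖dirSeq n‖⁻¹) • dirSeq n) (r := 1 / 20)
    (by norm_num) fun _ hb ↦ starConvex_annSector (dirSeq_ne_zero n) hb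

/-- **Lemma 2.2, (S1)–(S2) in weak form**: the annulus `A₁ = {1 < |x| < 2}` has weak solvability of the double
divergence (recursion over the fourteen sectors). [cite: MaoOhTao2023, Lemma 2.2] -/
theorem hasWeakDoubleDivInverse_annulus : HasWeakDoubleDivInverse {x : E3 | 1 < ‖x‖ ∧ ‖x‖ < 2} := by
  rw [← biUnion_annSector_dirSeq_eq]
  exact HasWeakDoubleDivInverse.biUnion_le (fun k ↦ isOpen_annSector _) hasWeakDoubleDivInverse_annSector_dirSeq
    dirSeq_chain 13

/-- **Lemma 2.2 (S1)–(S2), unfolded**: for every continuous compactly supported density `f` on `ℝ³` with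
`tsupp f ⊆ A₁` and `∫ f (1, x₁, x₂, x₃) dx = 0` there is a field `S^{ij}` with `supp S^{ij} ⊆ A₁` such that for all
`ψ ∈ C²_c(ℝ³)` the pairings converge and `Σ_{i,j} ∫ S^{ij} ∂ⱼ∂ᵢψ dx = ∫ f ψ dx`, i.e. `∂_i∂_j S^{ij} = f` in the sense of
distributions. [cite: MaoOhTao2023, Lemma 2.2] -/
theorem exists_weak_doubleDiv_inverse_annulus (f : E3 → ℝ) (hf : Continuous f) (hfc : HasCompactSupport f)
    (hfA : tsupport f ⊆ {x : E3 | 1 < ‖x‖ ∧ ‖x‖ < 2}) (hmom : ∀ μ, ∫ y : E3, f y * momentFn μ y = 0) :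
    ∃ S : Fin 3 → Fin 3 → E3 → ℝ, (∀ i j, support (S i j) ⊆ {x : E3 | 1 < ‖x‖ ∧ ‖x‖ < 2}) ∧
      ∀ ψ : E3 → ℝ, ContDiff ℝ 2 ψ → HasCompactSupport ψ →
        (∀ i j, Integrable fun x : E3 ↦ S i j x * pd j (pd i ψ) x) ∧
          ∑ i, ∑ j, ∫ x : E3, S i j x * pd j (pd i ψ) x = ∫ x : E3, f x * ψ x :=
  hasWeakDoubleDivInverse_annulus f hf hfc hfA hmom

end MaoOhTao

end Literature.Geometry.Lorentzian

end
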